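import Mathlib
import HarnessLib
import Summits.RiemannHypothesis.RiemannHypothesis.Theses.ScrewLemmaKExtremalRay
import Summits.RiemannHypothesis.RiemannHypothesis.Theorems.IntegerScrewSmoothSectorDefs
import Summits.RiemannHypothesis.RiemannHypothesis.Theorems.ScrewLemmaKCoprofileCalculus
import Summits.RiemannHypothesis.RiemannHypothesis.Theorems.ScrewLemmaKProfileBernoulli
import Summits.RiemannHypothesis.RiemannHypothesis.Theorems.ScrewLemmaKProfileBernoulliDefs
import Summits.RiemannHypothesis.RiemannHypothesis.Theorems.ScrewLemmaKProfileBernoulliC2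
import Summits.RiemannHypothesis.RiemannHypothesis.Theorems.ScrewLemmaKExtremalRayDefs
import Summits.RiemannHypothesis.RiemannHypothesis.Theorems.ScrewLemmaKExtremalRayGramRay
import Summits.RiemannHypothesis.RiemannHypothesis.Theorems.ScrewLemmaKExtremalRayMoebius
import Summits.RiemannHypothesis.RiemannHypothesis.Theorems.ScrewLemmaKExtremalRayOperatorBound
import Summits.RiemannHypothesis.RiemannHypothesis.Theorems.ScrewLemmaKExtremalRayApprox

/-!
# Route `ScrewLemmaKExtremalRay` (L24 «EXTREMAL RAY») — crux E1 `NearExtremalGenerators`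
# (stmt-RiemannHypothesis-22262): near-extremal smooth generators exist

For every `ε > 0` there is an admissible generator `g` (here a polynomial: `g(u) = −∫_u^1 φ`, `φ` a
polynomial), satisfying the leaf's integrability proviso `(h − h₀)²/y² ∈ L¹(0,1)`, whose co-profile
`Φ_g = Aφ` has `∫₀¹ Φ_g² ≤ (1/6 + ε)²` and `∫₀¹ Φ_g ≥ 1/36 − ε`.

Construction: `φ` is a polynomial `L²(0,1)`-close to the Möbius generator `φ*` (`Aφ* = r` exactly,
`coprofileOp_moebiusRay`; `r` the K3 Gram ray with `∫ r = ∫ r² = 1/36`) with the two moment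
corrections `⟨φ, u⟩ = ⟨φ, √u⟩ = 0` (`exists_polynomial_near_moebiusRay`), so that `g` is admissible
(integration by parts, `integral_deriv_mul_rpow_eq`) and of class `C²`, whence the proviso by the
second Euler–Maclaurin step (`exists_profile_sub_plateau_le_mul`: `ψ = O(y)`).  Then
`Φ_g = r + A(φ − φ*)` on `(0,1)` and the operator bound `‖A‖_{L²→L²} ≤ 3`
(`integral_coprofileOp_sq_le`) gives `‖A(φ − φ*)‖₂ ≤ ε`; Cauchy–Schwarz finishes:
`∫(r + e)² ≤ (1/6 + ‖e‖)²`, `∫(r + e) ≥ 1/36 − ‖e‖`.  Desk numerics (rh-idea-5, kappa_sequence.txt,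
kit j290989/j291079): κ(g_δ) ↓ 8.8711 at δ = 10⁻³ vs π² − 1 = 8.8696.  RH-free real analysis; L24
is a rung route onto `ScrewSmoothSectorKOptimal`; RH is not proved by this and nothing here bears on
the truth of RH.

Main result: `nearExtremalGenerators_proof : …Theses.ScrewLemmaKExtremalRay.NearExtremalGenerators`
(the route decl by name).
-/

set_option linter.dupNamespace false

noncomputable section

namespace Summit.RiemannHypothesis.RiemannHypothesis.Theorems.ScrewLemmaKExtremalRay

open MeasureTheory Set
open Summit.RiemannHypothesis.RiemannHypothesis.Theorems.IntegerScrew (SmoothSectorAdmissible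
  latticeProfile latticePlateau)
open Summit.RiemannHypothesis.RiemannHypothesis.Theorems.IntegerScrew.ProfileBernoulli (psiInt
  psiInt_eq stronglyMeasurable_psiInt exists_profile_sub_plateau_le_mul)
open Summit.RiemannHypothesis.RiemannHypothesis.Theorems.ScrewLemmaKCoprofile
  (integral_deriv_mul_rpow_eq)

/-! ## Cauchy–Schwarz (discriminant form) -/

/-- CAUCHY–SCHWARZ for two `L²` functions: `|∫ f g| ≤ √(∫ f²) · √(∫ g²)`. [folklore] -/
theorem abs_integral_mul_le_sqrt {μ : Measure ℝ} {f g : ℝ → ℝ} (hf : MemLp f 2 μ)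
    (hg : MemLp g 2 μ) :
    |∫ x, f x * g x ∂μ| ≤ Real.sqrt (∫ x, f x ^ 2 ∂μ) * Real.sqrt (∫ x, g x ^ 2 ∂μ) := by
  set F := ∫ x, f x ^ 2 ∂μ with hF
  set G := ∫ x, g x ^ 2 ∂μ with hG
  set P := ∫ x, f x * g x ∂μ with hP
  have hF0 : 0 ≤ F := integral_nonneg fun _ => sq_nonneg _
  have hG0 : 0 ≤ G := integral_nonneg fun _ => sq_nonneg _
  have hf2 : Integrable (fun x => f x ^ 2) μ := hf.integrable_sq
  have hg2 : Integrable (fun x => g x ^ 2) μ := hg.integrable_sq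
  have hfg : Integrable (fun x => f x * g x) μ := hf.integrable_mul hg
  have hquad : ∀ l : ℝ, 0 ≤ F - 2 * l * P + l ^ 2 * G := by
    intro l
    have h0 : 0 ≤ ∫ x, (f x - l * g x) ^ 2 ∂μ := integral_nonneg fun _ => sq_nonneg _
    have e : (fun x => (f x - l * g x) ^ 2)
        = fun x => f x ^ 2 - 2 * l * (f x * g x) + l ^ 2 * g x ^ 2 := by
      funext x; ring
    rw [e, integral_add, integral_sub, integral_const_mul, integral_const_mul] at h0
    · linarith [h0]
    · exact hf2
    · exact hfg.const_mul _
    · exact hf2.sub (hfg.const_mul _)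
    · exact hg2.const_mul _
  by_cases hG1 : G = 0
  · have hP0 : P = 0 := by
      by_contra hne
      have h1 := hquad (F / P)
      rw [hG1, mul_zero, add_zero] at h1
      have e1 : 2 * (F / P) * P = 2 * F := by field_simp
      rw [e1] at h1
      have hF' : F = 0 := le_antisymm (by linarith) hF0
      have h2 := hquad P
      rw [hG1, hF', mul_zero, add_zero] at h2
      have : P * P ≤ 0 := by linarith
      exact hne (by nlinarith [sq_nonneg P])
    rw [hP0, abs_zero]
    positivity
  · have hGpos : 0 < G := lt_of_le_of_ne hG0 (Ne.symm hG1)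
    have h1 := hquad (P / G)
    have e1 : F - 2 * (P / G) * P + (P / G) ^ 2 * G = F - P ^ 2 / G := by
      field_simp
      ring
    rw [e1] at h1
    have hP2 : P ^ 2 ≤ F * G := by
      have h2 : P ^ 2 / G ≤ F := by linarith
      rw [div_le_iff₀ hGpos] at h2
      linarith
    calc |P| = Real.sqrt (P ^ 2) := (Real.sqrt_sq_eq_abs P).symm
      _ ≤ Real.sqrt (F * G) := Real.sqrt_le_sqrt hP2
      _ = Real.sqrt F * Real.sqrt G := Real.sqrt_mul hF0 G

/-! ## The polynomial generator `g(u) = ∫_1^u φ` -/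

/-- A polynomial is `C^∞`. [folklore] -/
theorem contDiff_polynomial_eval (p : Polynomial ℝ) {n : WithTop ℕ∞} :
    ContDiff ℝ n (fun u : ℝ => p.eval u) := by
  have h := Polynomial.contDiff_aeval (𝕜 := ℝ) p n
  simpa only [Polynomial.coe_aeval_eq_eval] using h

/-- The primitive `u ↦ ∫_1^u φ` of a continuous `φ` has derivative `φ`. [folklore] -/
theorem hasDerivAt_primitive {φ : ℝ → ℝ} (hφ : Continuous φ) (u : ℝ) :
    HasDerivAt (fun x => ∫ v in (1:ℝ)..x, φ v) (φ u) u :=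
  (hφ.integral_hasStrictDerivAt 1 u).hasDerivAt

/-- The primitive of a `C^∞` function is `C²` (all we need). [folklore] -/
theorem contDiff_two_primitive {φ : ℝ → ℝ} (hφ : ContDiff ℝ 1 φ) :
    ContDiff ℝ 2 (fun x => ∫ v in (1:ℝ)..x, φ v) := by
  have hc : Continuous φ := hφ.continuous
  have hd : deriv (fun x => ∫ v in (1:ℝ)..x, φ v) = φ :=
    funext fun u => (hasDerivAt_primitive hc u).deriv
  have hdiff : Differentiable ℝ (fun x => ∫ v in (1:ℝ)..x, φ v) :=
    fun u => (hasDerivAt_primitive hc u).differentiableAt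
  rw [show (2 : WithTop ℕ∞) = 1 + 1 by norm_num, contDiff_succ_iff_deriv]
  refine ⟨hdiff, by simp, ?_⟩
  rw [hd]
  exact hφ

/-- ADMISSIBILITY FROM MOMENTS: if `g` is `C¹` on `[0,1]` with `deriv g = φ`, `g(1) = 0`,
`∫₀¹ φ(u)u du = 0` and `∫₀¹ φ(u)√u du = 0`, then `g` is admissible (two integrations by parts).
[folklore] -/
theorem admissible_of_moments {g φ : ℝ → ℝ} (hC : ContDiffOn ℝ 1 g (Icc 0 1))
    (hd : deriv g = φ) (h1 : g 1 = 0)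
    (hm1 : ∫ u in (0:ℝ)..1, φ u * u = 0) (hm2 : ∫ u in (0:ℝ)..1, φ u * u ^ (1 / 2 : ℝ) = 0) :
    SmoothSectorAdmissible g := by
  refine ⟨hC, h1, ?_, ?_⟩
  · -- `∫ g = -∫ φ u = 0`
    have h := integral_deriv_mul_rpow_eq hC one_pos
    rw [hd, h1] at h
    have e1 : (∫ u in (0:ℝ)..1, φ u * u ^ (1:ℝ)) = ∫ u in (0:ℝ)..1, φ u * u :=
      intervalIntegral.integral_congr fun u _ => by simp
    have e2 : (∫ u in (0:ℝ)..1, (1:ℝ) * u ^ ((1:ℝ) - 1) * g u) = ∫ u in (0:ℝ)..1, g u :=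
      intervalIntegral.integral_congr fun u _ => by simp
    rw [e1, e2, hm1] at h
    linarith
  · -- `∫ g u^{-1/2} = -2 ∫ φ √u = 0`
    have h := integral_deriv_mul_rpow_eq hC (by norm_num : (0:ℝ) < 1 / 2)
    rw [hd, h1, hm2] at h
    have e2 : (∫ u in (0:ℝ)..1, (1 / 2 : ℝ) * u ^ ((1 / 2 : ℝ) - 1) * g u)
        = (1 / 2) * ∫ u in (0:ℝ)..1, g u * u ^ (-(1 / 2 : ℝ)) := by
      rw [← intervalIntegral.integral_const_mul]
      refine intervalIntegral.integral_congr fun u _ => ?_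
      rw [show (1 / 2 : ℝ) - 1 = -(1 / 2) by norm_num]
      ring
    rw [e2] at h
    linarith

/-- THE PROVISO for `C²` data: `(h − h₀)²/y²` is integrable on `(0,1)` when `g ∈ C²[0,1]`,
`g(1) = 0`, `∫g = 0` (`ψ = O(y)`, second Euler–Maclaurin step). [folklore] -/
theorem integrableOn_profile_sq_div {g : ℝ → ℝ} (hC2 : ContDiffOn ℝ 2 g (Icc 0 1)) (h1 : g 1 = 0)
    (hI : ∫ u in (0:ℝ)..1, g u = 0) :
    IntegrableOn (fun y => (latticeProfile g y - latticePlateau g) ^ 2 / y ^ 2) (Ioo 0 1) := by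
  have hC1 : ContDiffOn ℝ 1 g (Icc 0 1) := hC2.of_le (by norm_num)
  obtain ⟨C, hC0, hC⟩ := exists_profile_sub_plateau_le_mul hC2 h1 hI
  have hEq : EqOn (fun y => (psiInt g y) ^ 2 / y ^ 2)
      (fun y => (latticeProfile g y - latticePlateau g) ^ 2 / y ^ 2) (Ioo (0:ℝ) 1) := by
    intro y hy
    simp only [psiInt_eq hC1 h1 hI hy.1]
  refine IntegrableOn.congr_fun ?_ hEq measurableSet_Ioo
  have hmeas : AEStronglyMeasurable (fun y => (psiInt g y) ^ 2 / y ^ 2)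
      (volume.restrict (Ioo (0:ℝ) 1)) :=
    (((stronglyMeasurable_psiInt g).measurable.pow_const 2).div
      (measurable_id.pow_const 2)).aestronglyMeasurable
  refine IntegrableOn.of_bound measure_Ioo_lt_top hmeas (C ^ 2) ?_
  rw [ae_restrict_iff' measurableSet_Ioo]
  refine Filter.Eventually.of_forall fun y hy => ?_
  have hy0 : 0 < y := hy.1
  have hb := hC y hy0
  rw [psiInt_eq hC1 h1 hI hy0, Real.norm_eq_abs, abs_div, abs_pow, abs_pow, abs_of_pos hy0,
    div_le_iff₀ (by positivity)]
  calc |latticeProfile g y - latticePlateau g| ^ 2 ≤ (C * y) ^ 2 :=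
        pow_le_pow_left₀ (abs_nonneg _) hb 2
    _ = C ^ 2 * y ^ 2 := by ring

/-! ## The closer -/

/-- **Item `NearExtremalGenerators` (E1, stmt-RiemannHypothesis-22262)**, the route decl by name:
for every `ε > 0` there is an admissible `g` with the integrability proviso, `∫₀¹ Φ_g² ≤ (1/6 + ε)²`
and `∫₀¹ Φ_g ≥ 1/36 − ε`. RH-free. [folklore] -/
theorem nearExtremalGenerators_proof :
    Summit.RiemannHypothesis.RiemannHypothesis.Theses.ScrewLemmaKExtremalRay.NearExtremalGenerators := by
  unfold Summit.RiemannHypothesis.RiemannHypothesis.Theses.ScrewLemmaKExtremalRay.NearExtremalGenerators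
  intro ε hε
  -- the polynomial `φ`, `L²`-close to the Möbius generator, with the two moment corrections
  obtain ⟨p, hp, hm1, hm2⟩ := exists_polynomial_near_moebiusRay (ε ^ 2 / 9) (by positivity)
  set φ : ℝ → ℝ := fun u => p.eval u with hφ
  have hφs : ContDiff ℝ 1 φ := contDiff_polynomial_eval p
  have hφc : Continuous φ := hφs.continuous
  have hφm : Measurable φ := hφc.measurable
  -- the generator `g(u) = ∫_1^u φ = -∫_u^1 φ`
  set g : ℝ → ℝ := fun x => ∫ v in (1:ℝ)..x, φ v with hg
  have hgd : deriv g = φ := funext fun u => (hasDerivAt_primitive hφc u).deriv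
  have hg1 : g 1 = 0 := by simp [hg]
  have hg2 : ContDiff ℝ 2 g := contDiff_two_primitive hφs
  have hC2 : ContDiffOn ℝ 2 g (Icc 0 1) := hg2.contDiffOn
  have hC1 : ContDiffOn ℝ 1 g (Icc 0 1) := hC2.of_le (by norm_num)
  have hadm : SmoothSectorAdmissible g := admissible_of_moments hC1 hgd hg1 hm1 hm2
  refine ⟨g, hadm, integrableOn_profile_sq_div hC2 hg1 hadm.2.2.1, ?_⟩
  -- the error term `e = A(φ - φ*)`
  set μI : Measure ℝ := volume.restrict (Ioo (0:ℝ) 1) with hμI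
  haveI : IsFiniteMeasure μI := by
    rw [hμI]; exact isFiniteMeasure_restrict.mpr measure_Ioo_lt_top.ne
  have hψm : Measurable (fun u => φ u - moebiusRay u) := hφm.sub measurable_moebiusRay
  obtain ⟨B, hB⟩ := isCompact_Icc.exists_bound_of_continuousOn
    (hφc.continuousOn : ContinuousOn φ (Icc (0:ℝ) 1))
  have hφL2 : MemLp φ 2 μI := by
    refine MemLp.of_bound hφc.aestronglyMeasurable B ?_
    rw [hμI, ae_restrict_iff' measurableSet_Ioo]
    exact Filter.Eventually.of_forall fun u hu => hB u (Ioo_subset_Icc_self hu)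
  have hψL2 : MemLp (fun u => φ u - moebiusRay u) 2 μI := hφL2.sub memLp_two_moebiusRay
  have hψ2 : IntegrableOn (fun u => (φ u - moebiusRay u) ^ 2) (Ioo 0 1) :=
    (memLp_two_iff_integrable_sq hψL2.1).mp hψL2
  set e : ℝ → ℝ := coprofileOp (fun u => φ u - moebiusRay u) with he
  have hem : Measurable e := measurable_coprofileOp hψm
  have he2 : IntegrableOn (fun t => e t ^ 2) (Ioo 0 1) := integrableOn_coprofileOp_sq hψm hψ2
  have he2le : ∫ t in Ioo (0:ℝ) 1, e t ^ 2 ≤ ε ^ 2 := by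
    calc ∫ t in Ioo (0:ℝ) 1, e t ^ 2 ≤ 9 * ∫ u in Ioo (0:ℝ) 1, (φ u - moebiusRay u) ^ 2 :=
          integral_coprofileOp_sq_le hψm hψ2
      _ ≤ 9 * (ε ^ 2 / 9) := by gcongr
      _ = ε ^ 2 := by ring
  have heL2 : MemLp e 2 μI := (memLp_two_iff_integrable_sq hem.aestronglyMeasurable).mpr he2
  -- the Gram ray and the constant `1` in `L²(0,1)`
  have hrL2 : MemLp gramRay 2 μI := by
    refine MemLp.of_bound continuous_gramRay.aestronglyMeasurable 5 ?_
    rw [hμI, ae_restrict_iff' measurableSet_Ioo]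
    exact Filter.Eventually.of_forall fun t ht => abs_gramRay_le (Ioo_subset_Icc_self ht)
  have h1L2 : MemLp (fun _ : ℝ => (1:ℝ)) 2 μI := memLp_const 1
  -- `Φ_g = r + e` on `(0,1)`
  have hAφ : ∀ t ∈ Ioo (0:ℝ) 1,
      (∑ n ∈ Finset.Icc 1 ⌊1 / t⌋₊, deriv g (n * t) / n) = gramRay t + e t := by
    intro t ht
    have h1 : (∑ n ∈ Finset.Icc 1 ⌊1 / t⌋₊, deriv g (n * t) / n) = coprofileOp φ t := by
      rw [hgd]; rfl
    rw [h1, he, coprofileOp_sub, coprofileOp_moebiusRay ⟨ht.1, ht.2.le⟩]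
    ring
  -- the scalar quantities
  set s := Real.sqrt (∫ t in Ioo (0:ℝ) 1, e t ^ 2) with hs
  have hs0 : 0 ≤ s := Real.sqrt_nonneg _
  have hsε : s ≤ ε := by
    rw [hs, ← Real.sqrt_sq hε.le]
    exact Real.sqrt_le_sqrt he2le
  have hss : s ^ 2 = ∫ t in Ioo (0:ℝ) 1, e t ^ 2 :=
    Real.sq_sqrt (integral_nonneg fun _ => sq_nonneg _)
  have hsqrt_r : Real.sqrt (∫ t in Ioo (0:ℝ) 1, gramRay t ^ 2) = 1 / 6 := by
    rw [setIntegral_gramRay_sq, show (1 / 36 : ℝ) = (1 / 6) ^ 2 by norm_num,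
      Real.sqrt_sq (by norm_num)]
  have hsqrt_1 : Real.sqrt (∫ t in Ioo (0:ℝ) 1, (fun _ : ℝ => (1:ℝ)) t ^ 2) = 1 := by
    simp
  have hP : |∫ t in Ioo (0:ℝ) 1, gramRay t * e t| ≤ 1 / 6 * s := by
    have := abs_integral_mul_le_sqrt hrL2 heL2
    rw [hsqrt_r] at this
    exact this
  have hM : |∫ t in Ioo (0:ℝ) 1, e t| ≤ s := by
    have := abs_integral_mul_le_sqrt heL2 h1L2
    simp only [mul_one] at this
    rw [hsqrt_1, mul_one] at this
    exact this
  -- integrability on `(0,1)`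
  have hr2 : IntegrableOn (fun t => gramRay t ^ 2) (Ioo 0 1) := hrL2.integrable_sq
  have hre : IntegrableOn (fun t => gramRay t * e t) (Ioo 0 1) := hrL2.integrable_mul heL2
  have hr1 : IntegrableOn gramRay (Ioo (0:ℝ) 1) := hrL2.integrable one_le_two
  have he1 : IntegrableOn e (Ioo (0:ℝ) 1) := heL2.integrable one_le_two
  constructor
  · -- energy: `∫ (r + e)² = 1/36 + 2∫re + ∫e² ≤ (1/6 + s)² ≤ (1/6 + ε)²`
    have hcongr : ∫ t in Ioo (0:ℝ) 1, (∑ n ∈ Finset.Icc 1 ⌊1 / t⌋₊, deriv g (n * t) / n) ^ 2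
        = ∫ t in Ioo (0:ℝ) 1, (gramRay t + e t) ^ 2 :=
      setIntegral_congr_fun measurableSet_Ioo fun t ht => by rw [hAφ t ht]
    have hexp : ∫ t in Ioo (0:ℝ) 1, (gramRay t + e t) ^ 2
        = (∫ t in Ioo (0:ℝ) 1, gramRay t ^ 2) + 2 * (∫ t in Ioo (0:ℝ) 1, gramRay t * e t)
          + ∫ t in Ioo (0:ℝ) 1, e t ^ 2 := by
      have e1 : (fun t => (gramRay t + e t) ^ 2)
          = fun t => gramRay t ^ 2 + 2 * (gramRay t * e t) + e t ^ 2 := by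
        funext t; ring
      rw [e1, integral_add, integral_add, integral_const_mul]
      · exact hr2
      · exact hre.const_mul _
      · exact hr2.add (hre.const_mul _)
      · exact he2
    rw [hcongr, hexp, setIntegral_gramRay_sq, ← hss]
    have hP' := (abs_le.mp hP).2
    nlinarith [hP', hsε, hs0, hε]
  · -- mean: `∫ (r + e) = 1/36 + ∫ e ≥ 1/36 - s ≥ 1/36 - ε`
    have hcongr : ∫ t in Ioo (0:ℝ) 1, (∑ n ∈ Finset.Icc 1 ⌊1 / t⌋₊, deriv g (n * t) / n)
        = ∫ t in Ioo (0:ℝ) 1, (gramRay t + e t) :=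
      setIntegral_congr_fun measurableSet_Ioo fun t ht => by rw [hAφ t ht]
    rw [hcongr, integral_add hr1 he1, setIntegral_gramRay]
    have hM' := (abs_le.mp hM).1
    linarith
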